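import Summits.CriticalPhenomena.CardyFormulaZ2.Theses.CardyComplexCone
import Literature.Probability.Percolation.InterfaceCurves
import Literature.Probability.RandomPlanarGeometry.ConformalRectangleProofs
import Literature.Probability.RandomPlanarGeometry.CardyFunctionIncBeta
import Literature.Probability.RandomPlanarGeometry.CollarDomain
import Literature.Topology.PlaneTopology.Crosscut

/-!
# Skeleton line `collar-touch-sandwich` for crux `SLESixFamiliesGiveCardy` (stmt-CriticalPhenomena-9654)
# — lead reshape r1 (prover-line-stmt-CriticalPhenomena-9654-0, 2026-08-16)

Route `CardyComplexCone`, crux r6 `SLESixFamiliesGiveCardy = SLE6Families → CardyFormulaZ2`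
(`SLE6Families`: for EVERY Dobrushin domain `D` and EVERY discretisation family `Λ` of `D` — six
unbundled `ZdDiscretisationFamily` guards — the endpoint-oriented medial exploration interface of
bond percolation at `p = 1/2` converges in law to chordal SLE₆ in `D`).  Planner `crux-plan`
skeleton (idea card `Ideas/collar-touch-sandwich.md`, ideator 3, r1; triage r1: 3 × pass), adopted
by the line lead (`PICKED.md`) and RESHAPED (r1):

* the planner's STUB E `CollarRectangles` (construction + Radó modulus control in one statement,
  XL) is split into STUB E `CollarDomains` (pure construction: the two exterior-collared comparison
  rectangles with smooth exterior marks, their boundary loops UNIFORMLY `ε`-close to the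
  re-based loop of `R` with `ε`-close mark parameters) and STUB G `ModulusContinuity` (pure Radó:
  `ε`-close loops and marks ⇒ `θ`-close cross-ratios of the uniformizing data); the cyclic
  relabelling `(c, d, a, b)` of the lower comparison rectangle is absorbed by the composition
  (`rotateTwo`, `crossRatio_rotateTwo`: a Möbius lemma, proved here, no stub);
* every stub is stated BY NAME (`theorem stub_X : X`), the seven statements `X` being the named
  `Prop`s of §2; the vocabulary (`UpperCollarGeom`, `LowerCollarGeom`, `IsSmoothMark`) and the
  seven statements move verbatim to the definitions module
  `Theorems/CardyComplexConeDefs.lean` (same namespace) so that the stub helper files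
  `Theorems/CardyComplexConeSLESixFamiliesGiveCardy<Stub>.lean` and the closing file share one
  copy; 7 stubs = `stubs_max`.

## The line (touch-free Cardy readout through collared Dobrushin problems)

Fix a conformal rectangle `R = (Ω; a, b, c, d)`, `C_δ = discreteCrossing Ω δ (ab) (cd)` the FREE
crossing event of the summit.  `H = SLE6Families` is consumed at two DESIGNER Dobrushin domains per
`R`, both containing `Ω`, with marked points OUTSIDE `closure Ω` on smooth exterior collar arcs:

* `D₁ = Q₁.chord 0 1`, `Q₁ = (Ω₁; a⁺, b⁺, c′, d′)`, `Ω₁ = Ω ∪` tube collars glued behind shortened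
  side arcs `[b′c′] ⊂ (bc)°`, `[d′a′] ⊂ (da)°`; wired arc `= Q₁.arc 0 ⊇ (ab)`, touch set
  `G₁ = Q₁.arc 2 = [c′c] ∪ (cd) ∪ [dd′] = (dual arc) ∩ closure Ω`;
* `D₂ = Q₂.chord 0 3`, `Q₂ = (Ω₂; c⁺, d′, a′, b⁺)` (≈ `R` relabelled `(c, d, a, b)` = `rotateTwo R`),
  `Ω₂ = Ω ∪` collars behind `[a′b′] ⊂ (ab)°`, `[c′d′] ⊂ (cd)°`; wired arc = the LONG arc
  `c⁺ → d′ → a′ → b⁺ ⊇ (da)`, touch set `G₂ = Q₂.arc 1 = [d′d] ∪ (da) ∪ [aa′] = (wired arc) ∩ closure Ω`.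

Deterministically, for every `η > 0` and all small `δ` (STUBS A, B — the lattice heart of the line):
`C_δ ⊆ {trace γ₁ meets N̄_η G₁}` (the RIGHT/dual fence of `γ₁` is a Newman cross-cut of `Ω₁` from
near `a⁺` to near `b⁺` — under JCT an inner face is an open square inside `Ω₁` and the open side
shared by two inner faces lies inside `Ω₁`, so the fence needs no re-routing; an `ω`-open
`Ω_δ`-path from `(ab)_δ` to `(cd)_δ`, extended to `∂Ω`, must cross it at a bc-closed ω-open edge,
whose dual-wired endpoint lies in `Ω`, hence near `G₁`) and `{trace γ₂ avoids N̄_η G₂} ⊆ C_δ` (the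
LEFT/bc-open chain of `γ₂` runs from the `(cd)`-collar to the `(ab)`-collar; its last transit
through `Ω` between gates is an honest `ω`-open `Ω_δ`-crossing).  Both target events are CLOSED
range events in `CurveClass ℂ` (`hitsBefore K ∅`, `isClosed_hitsBefore_empty_right`), so closed-set
portmanteau along `𝓝[>] 0` (STUB C) bounds `limsup P[C_δ]` and `limsup P[C_δᶜ]` by SLE₆ touch
probabilities of `N̄_η G₁`, `N̄_η G₂` — no a.s.-continuity, no hitting ORDER, no arm estimate, no
orientation case split.  STUB D (SLE₆ side-arc touch law = Rohde–Schramm same-side law, `κ = 6`):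
as `η ↓ 0` these tend to `F(η_{Q₁})` and `1 - F(η_{Q₂})`; STUBS E + G make `|η_{Qᵢ} - η_R| ≤ θ`;
STUB F supplies the admissible discretisation families of the designer domains (smooth exterior
marks only — item 9644 at rough marks is NOT consumed).  The composition assembles
`F(η_R) - 4ε ≤ P[C_δ] ≤ F(η_R) + 4ε` eventually, using only `P C + P Cᶜ ≥ 1`.

## Disproof used (`Cruxes/SLESixFamiliesGiveCardy/Disproof.lean`, cdisprove gen 2 cycle 2, rc 0)

* §1 `crux_iff` (shape `SLE6Families → CardyFormulaZ2`): the composition is literally such a proof;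
  the Disproof has NO `_false_without_<H>` theorem, so there is no obstruction hypothesis to honour —
  `H` is consumed non-vacuously at two designer domains per rectangle (§2 `familyHyps_discData`
  pattern: the line builds its own families, STUB F).
* gen-1/§3 `hitsBefore_not_isOpen/_not_isClosed`, `not_naiveHittingTransfer`,
  `not_interfaceHittingTransfer`, `disc_hitting_prob_eq_zero` (REFUTED strengthening): honoured by
  construction — no stub evaluates `hitsBefore (arc) (arc)` on a lattice curve; only CLOSED range
  events `hitsBefore (cthickening η G) ∅` are transported, by limsup portmanteau (STUB C), and
  `η ↓ 0` is taken on the SLE side (STUB D).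
* §2b `orientation_loadBearing`, §3/§4 `exactDictionary_holds`: not needed — range events are
  orientation-free (`Interface.range_bondInterfaceIn`).
* §3 DUALITY-STEP JUNK (`prob_add_prob_eq`): the composition uses complementary events of ONE free
  crossing, `P C + P Cᶜ ≥ 1` automatic (no `p + q ≤ 1 + ε`).
* Negatives index: only stmt-0748 (`NegDegenerateArcs`) touches this conjunct; all limits here are
  `F(η) ∈ (0,1)`.  No `Negative/` lemma has landed for this crux (nothing to import).
-/

noncomputable section

open Set Filter Topology Metric MeasureTheory
open scoped NNReal
open UpperHalfPlane (upperHalfPlaneSet)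
open Literature.Probability Literature.Probability.RandomPlanarGeometry
  Literature.Probability.LatticeModels Literature.Probability.Percolation

namespace Summit.CriticalPhenomena.CardyFormulaZ2.Cruxes.SLESixFamiliesGiveCardy.CollarTouchSandwich

/-! ### Continuum interface predicates between the geometry stub and the lattice stubs

They isolate exactly what the two deterministic inclusions use about a collared Dobrushin domain
`D ⊇ Ω` and its touch set `G`; STUB E constructs domains satisfying them. -/

/-- **Geometry of the UPPER readout.**  `D` is a Dobrushin domain containing the conformal
rectangle `R = (Ω; a, b, c, d)`, whose marked points lie outside `closure Ω`, whose wired arc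
`D.arc 0` contains every frontier point of `Ω` near `(ab) = R.arc 0` and whose dual-wired arc
`D.arc 1` contains every frontier point of `Ω` near `(cd) = R.arc 2`, and whose closure outside
`closure Ω` stays away from `(ab) ∪ (cd)`; the touch set `G` contains `(cd)` and every point of the
dual-wired arc lying in `closure Ω` (so dual-wired lattice sites inside `Ω` are `o(1)`-close to `G`).
Model: `D = Q₁.chord 0 1`, `G = Q₁.arc 2` of the module docstring. -/
structure UpperCollarGeom (R : ConformalRectangle) (D : DobrushinDomain) (G : Set ℂ) : Prop where
  /-- `Ω ⊆ D`. -/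
  carrier_subset : R.carrier ⊆ D.carrier
  /-- The touch set contains the far arc `(cd)` (in particular it is nonempty). -/
  arc_two_subset : R.arc 2 ⊆ G
  /-- Dual-wired boundary points inside `closure Ω` belong to the touch set. -/
  arc_one_inter_closure_subset : D.arc 1 ∩ closure R.carrier ⊆ G
  /-- The two marked points of `D` lie outside `closure Ω`. -/
  pt_not_mem_closure : ∀ i : Fin 2, D.pt i ∉ closure R.carrier
  /-- Frontier points of `Ω` near `(ab)` are wired boundary points of `D`. -/
  near_arc_zero : ∃ r : ℝ, 0 < r ∧ ∀ z ∈ frontier R.carrier, infDist z (R.arc 0) < r → z ∈ D.arc 0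
  /-- Frontier points of `Ω` near `(cd)` are dual-wired boundary points of `D`. -/
  near_arc_two : ∃ r : ℝ, 0 < r ∧ ∀ z ∈ frontier R.carrier, infDist z (R.arc 2) < r → z ∈ D.arc 1
  /-- The part of `closure D` outside `closure Ω` (the collars and their outer boundaries) keeps a
  positive distance from the two arcs `(ab)`, `(cd)` read by the crossing event. -/
  closure_far : ∃ s : ℝ, 0 < s ∧ ∀ z ∈ closure D.carrier, z ∉ closure R.carrier →
    s ≤ infDist z (R.arc 0) ∧ s ≤ infDist z (R.arc 2)

/-- **Geometry of the LOWER readout.**  `D ⊇ Ω` with marks outside `closure Ω`; the touch set `G`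
contains `(da) = R.arc 3` and every point of the WIRED arc `D.arc 0` lying in `closure Ω`; and the
part of `D` outside `Ω` splits into two pieces `C₀`, `C₂` (the collars glued behind shortened
sub-arcs of `(ab)` and of `(cd)`) at distance `≥ r` from each other, `C₀` at distance `≥ r` from the
three arcs other than `(ab)`, `C₂` at distance `≥ r` from the three arcs other than `(cd)`, the mark
`D.pt 1` inside the `C₀`-collar and `D.pt 0` inside the `C₂`-collar.  Model: `D = Q₂.chord 0 3`,
`G = Q₂.arc 1` of the module docstring. -/
structure LowerCollarGeom (R : ConformalRectangle) (D : DobrushinDomain) (G : Set ℂ) : Prop where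
  /-- `Ω ⊆ D`. -/
  carrier_subset : R.carrier ⊆ D.carrier
  /-- The touch set contains the arc `(da)` (in particular it is nonempty). -/
  arc_three_subset : R.arc 3 ⊆ G
  /-- Wired boundary points inside `closure Ω` belong to the touch set. -/
  arc_zero_inter_closure_subset : D.arc 0 ∩ closure R.carrier ⊆ G
  /-- The two marked points of `D` lie outside `closure Ω`. -/
  pt_not_mem_closure : ∀ i : Fin 2, D.pt i ∉ closure R.carrier
  /-- The exterior part of `D` splits into an `(ab)`-collar `C₀` and a `(cd)`-collar `C₂`. -/
  split : ∃ (C₀ C₂ : Set ℂ) (r : ℝ), 0 < r ∧ D.carrier \ R.carrier ⊆ C₀ ∪ C₂ ∧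
    (∀ z ∈ C₀, ∀ w ∈ C₂, r ≤ dist z w) ∧
    (∀ z ∈ C₀, r ≤ infDist z (R.arc 1) ∧ r ≤ infDist z (R.arc 2) ∧ r ≤ infDist z (R.arc 3)) ∧
    (∀ z ∈ C₂, r ≤ infDist z (R.arc 0) ∧ r ≤ infDist z (R.arc 1) ∧ r ≤ infDist z (R.arc 3)) ∧
    ball (D.pt 0) r ∩ D.carrier ⊆ C₂ ∧ ball (D.pt 1) r ∩ D.carrier ⊆ C₀

/-- **Smooth exterior mark.**  Near its `i`-th marked point the Dobrushin domain `D` is, after a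
LATTICE rotation `w ↦ D.pt i + e w` (`e ∈ {1, I, -1, -I}`), the strict epigraph `{im w > g (re w)}`
of a `C²` function with `g 0 = 0` which is either in GENERAL POSITION (`0 < |g′ 0| < 1`: tangent off
the eight lattice directions) or EXACTLY affine along a lattice direction (`g = c·x`, `c ∈ {0, ±1}`).
This is the designer-junction regularity under which admissible discretisation families are a
local, monotone-staircase statement (STUB F); the collars of STUB E place their marks so. -/
def IsSmoothMark (D : DobrushinDomain) (i : Fin 2) : Prop :=
  ∃ (e : ℂ) (g : ℝ → ℝ) (r : ℝ), (e = 1 ∨ e = Complex.I ∨ e = -1 ∨ e = -Complex.I) ∧ 0 < r ∧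
    ContDiffOn ℝ 2 g (Ioo (-r) r) ∧ g 0 = 0 ∧
    ((0 < |deriv g 0| ∧ |deriv g 0| < 1) ∨ (∃ c : ℝ, (c = 0 ∨ c = 1 ∨ c = -1) ∧ ∀ t, g t = c * t)) ∧
    ∀ w : ℂ, ‖w‖ < r → (D.pt i + e * w ∈ D.carrier ↔ g w.re < w.im)

/-! ### The six statements of the line

Each statement is a precise `Prop`, restated verbatim by its registered `theorem stub_… := by sorry`
below (the only `sorry`s of the file) and aliased under the stub's short name in the
implementation-detail namespace `__Registered` (the hypotheses of `SLESixFamiliesGiveCardy_of`,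
admissible BY NAME for the native skeleton audit); `sleSixFamiliesGiveCardy_proof` applies the
composition to the six `stub_…` literally, which checks that statements, aliases and stubs agree. -/

/-- STATEMENT A — **the upper fence inclusion** (deterministic, eventually in the mesh): under
`UpperCollarGeom R D G`, for every discretisation family `Λ` of `D` and every `η > 0`, for all small
`δ > 0` every configuration with a free open crossing of `Ω_δ` from `(ab)_δ` to `(cd)_δ` has the
trace of its medial exploration interface in `Λ δ` within `η` of `G`. -/
def UpperFence : Prop :=
  ∀ (R : ConformalRectangle) (D : DobrushinDomain) (G : Set ℂ), UpperCollarGeom R D G →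
    ∀ (Λ : ℝ → DiscreteDobrushin), ZdDiscretisationFamily D Λ →
      ∀ η : ℝ, 0 < η → ∀ᶠ δ : ℝ in 𝓝[>] 0,
        discreteCrossing R.carrier δ (R.arc 0) (R.arc 2) ⊆
          {ω | (range (medialExplorationCurve (Λ δ) ω) ∩ cthickening η G).Nonempty}

/-- STATEMENT B — **the lower run inclusion** (deterministic, eventually in the mesh): under
`LowerCollarGeom R D G`, for every discretisation family `Λ` of `D` and every `η > 0`, for all small
`δ > 0` every configuration whose interface trace in `Λ δ` stays `η`-away from `G` has a free open
crossing of `Ω_δ` from `(ab)_δ` to `(cd)_δ`. -/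
def LowerRun : Prop :=
  ∀ (R : ConformalRectangle) (D : DobrushinDomain) (G : Set ℂ), LowerCollarGeom R D G →
    ∀ (Λ : ℝ → DiscreteDobrushin), ZdDiscretisationFamily D Λ →
      ∀ η : ℝ, 0 < η → ∀ᶠ δ : ℝ in 𝓝[>] 0,
        {ω | Disjoint (range (medialExplorationCurve (Λ δ) ω)) (cthickening η G)} ⊆
          discreteCrossing R.carrier δ (R.arc 0) (R.arc 2)

/-- STATEMENT C — **closed-set portmanteau along the mesh filter** (pure measure theory): if the
random curve classes `X δ` converge in law (`TendstoLaw`, bounded continuous test functions) to an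
a.e.-measurable `Γ` under the pre-Wiener measure and are eventually a.e.-measurable, then every
family of events eventually contained in "the trace of `X δ` meets the closed set `K`" has, for each
`ε > 0`, eventually probability at most `Law(Γ)(trace meets K) + ε`. -/
def TouchLimsup : Prop :=
  ∀ (X : ℝ → BondConfig (Site 2) → CurveClass ℂ) (Γ : (ℝ≥0 → ℝ) → CurveClass ℂ),
    AEMeasurable Γ Process.preWienerMeasure →
    (∀ᶠ δ : ℝ in 𝓝[>] 0, AEMeasurable (X δ) (bondPercolation (zdGraph 2) Percolation.half)) →
    TendstoLaw X (fun _ => bondPercolation (zdGraph 2) Percolation.half) Γ Process.preWienerMeasure →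
    ∀ (K : Set ℂ), IsClosed K → ∀ (E : ℝ → Set (BondConfig (Site 2))),
      (∀ᶠ δ : ℝ in 𝓝[>] 0, E δ ⊆ {ω | ((X δ ω).range ∩ K).Nonempty}) →
      ∀ ε : ℝ, 0 < ε → ∀ᶠ δ : ℝ in 𝓝[>] 0,
        (bondPercolation (zdGraph 2) Percolation.half).real (E δ) ≤
          (Process.preWienerMeasure.map Γ).real (CurveClass.hitsBefore K (∅ : Set ℂ)) + ε

/-- STATEMENT D — **the SLE₆ side-arc touch law** (two readings of Rohde–Schramm's same-side law at
`κ = 6`): for a conformal rectangle `Q = (p₀, p₁, p₂, p₃)` with uniformizing datum `(φ, x)`,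
(U) chordal SLE₆ in `Q.chord 0 1` (from `p₀` to `p₁`) touches the closed `η`-neighbourhood of the
far arc `Q.arc 2 = (p₂p₃)` with probability tending, as `η → 0⁺`, to `F(crossRatio x)`;
(L) chordal SLE₆ in `Q.chord 0 3` (from `p₀` to `p₃`) touches the closed `η`-neighbourhood of the
middle arc `Q.arc 1 = (p₁p₂)` of its own (long) arc `0` with probability tending to
`1 - F(crossRatio x)`.  Stated for EVERY SLE₆ random curve of the domain (no law uniqueness used). -/
def SleSideTouch : Prop :=
  ∀ (Q : ConformalRectangle) (φ : ConformalEquiv upperHalfPlaneSet Q.carrier) (x : Fin 4 → ℝ),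
    Q.IsUniformizing φ x →
    (∀ Γ : (ℝ≥0 → ℝ) → CurveClass ℂ, IsSLECurve 6 (Q.chord 0 1 (by decide)) Γ →
      Tendsto (fun η : ℝ => (Process.preWienerMeasure.map Γ).real
          (CurveClass.hitsBefore (cthickening η (Q.arc 2)) (∅ : Set ℂ)))
        (𝓝[>] 0) (𝓝 (RandomPlanarGeometry.cardyFunction (crossRatio x)))) ∧
    (∀ Γ : (ℝ≥0 → ℝ) → CurveClass ℂ, IsSLECurve 6 (Q.chord 0 3 (by decide)) Γ →
      Tendsto (fun η : ℝ => (Process.preWienerMeasure.map Γ).real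
          (CurveClass.hitsBefore (cthickening η (Q.arc 1)) (∅ : Set ℂ)))
        (𝓝[>] 0) (𝓝 (1 - RandomPlanarGeometry.cardyFunction (crossRatio x))))

/-- STATEMENT E — **exterior-collared comparison rectangles** (pure construction, lead reshape r1 of
the planner's `CollarRectangles`): for every conformal rectangle `R` and every `ε > 0` there are
(upper) a conformal rectangle `Q = (Ω₁; a⁺, b⁺, c′, d′)` with `UpperCollarGeom R (Q.chord 0 1) (Q.arc 2)`
and smooth exterior marks `a⁺, b⁺`, and (lower) a conformal rectangle `Q = (Ω₂; c⁺, d′, a′, b⁺)` with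
`LowerCollarGeom R (Q.chord 0 3) (Q.arc 1)` and smooth exterior marks `c⁺, b⁺`, each with its
boundary loop UNIFORMLY `ε`-close to the loop of `R` re-based by a shift `c`
(`dist (Q.boundary s) (R.boundary (s + c)) ≤ ε` for all `s`) and its mark parameters `ε`-close,
after the same shift, to those of `R` — for the lower rectangle to those of `R` relabelled
`(c, d, a, b)`, i.e. to `(mark 2, mark 3, mark 0 + 1, mark 1 + 1)`.  Model: tube collars of
conformal width `h → 0` glued behind shortened sub-arcs whose attaching points tend to the corners
(`ConformalTube`, `CollarDomain`), marks on plateau arcs of the outer collar boundary. -/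
def CollarDomains : Prop :=
  ∀ (R : ConformalRectangle) (ε : ℝ), 0 < ε →
    (∃ (Q : ConformalRectangle) (c : ℝ), UpperCollarGeom R (Q.chord 0 1 (by decide)) (Q.arc 2) ∧
        IsSmoothMark (Q.chord 0 1 (by decide)) 0 ∧ IsSmoothMark (Q.chord 0 1 (by decide)) 1 ∧
        (∀ s : ℝ, dist (Q.boundary s) (R.boundary (s + c)) ≤ ε) ∧
        ∀ i : Fin 4, |Q.mark i + c - R.mark i| ≤ ε) ∧
    (∃ (Q : ConformalRectangle) (c : ℝ), LowerCollarGeom R (Q.chord 0 3 (by decide)) (Q.arc 1) ∧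
        IsSmoothMark (Q.chord 0 3 (by decide)) 0 ∧ IsSmoothMark (Q.chord 0 3 (by decide)) 1 ∧
        (∀ s : ℝ, dist (Q.boundary s) (R.boundary (s + c)) ≤ ε) ∧
        |Q.mark 0 + c - R.mark 2| ≤ ε ∧ |Q.mark 1 + c - R.mark 3| ≤ ε ∧
        |Q.mark 2 + c - (R.mark 0 + 1)| ≤ ε ∧ |Q.mark 3 + c - (R.mark 1 + 1)| ≤ ε)

/-- STATEMENT G — **continuity of the conformal modulus** (Radó; lead reshape r1): for every conformal
rectangle `R` with uniformizing datum `(φ, x)` and every `θ > 0` there is `ε > 0` such that every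
conformal rectangle `Q` whose boundary loop is uniformly `ε`-close to a re-basing `s ↦ R.boundary (s + c)`
of the loop of `R`, with mark parameters `ε`-close after the same shift, has all its uniformizing data
`(φ', x')` with `|crossRatio x' - crossRatio x| ≤ θ`.  (Radó's theorem `rado_tendstoUniformlyOn_holds`
along sequences, Carathéodory injectivity on the closed disc, `cCrossRatio` continuity, argued by
contradiction for the `∃ ε`.) -/
def ModulusContinuity : Prop :=
  ∀ (R : ConformalRectangle) (φ : ConformalEquiv upperHalfPlaneSet R.carrier) (x : Fin 4 → ℝ),
    R.IsUniformizing φ x → ∀ θ : ℝ, 0 < θ → ∃ ε : ℝ, 0 < ε ∧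
      ∀ (Q : ConformalRectangle) (c : ℝ), (∀ s : ℝ, dist (Q.boundary s) (R.boundary (s + c)) ≤ ε) →
        (∀ i : Fin 4, |Q.mark i + c - R.mark i| ≤ ε) →
        ∀ (φ' : ConformalEquiv upperHalfPlaneSet Q.carrier) (x' : Fin 4 → ℝ),
          Q.IsUniformizing φ' x' → |crossRatio x' - crossRatio x| ≤ θ

/-- STATEMENT F — **admissible discretisation families at smooth exterior marks**: a Dobrushin
domain both of whose marked points are smooth marks (`IsSmoothMark`) carries a square-lattice
discretisation family (`ZdDiscretisationFamily`: domain and mesh fixed, arcs and discrete marked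
points Hausdorff-convergent, `IsZdAdmissible` for all small meshes). -/
def SmoothMarkFamilies : Prop :=
  ∀ D : DobrushinDomain, IsSmoothMark D 0 → IsSmoothMark D 1 →
    ∃ Λ : ℝ → DiscreteDobrushin, ZdDiscretisationFamily D Λ

/-! ### Relabelling a conformal rectangle by two (composition bookkeeping, proved here) -/

/-- The conformal rectangle `R = (Ω; a, b, c, d)` relabelled `(Ω; c, d, a, b)` and re-based so that the
marks increase in `[0,1)`: boundary loop `s ↦ R.boundary (s + R.mark 2)`, marks
`(0, m₃ - m₂, m₀ + 1 - m₂, m₁ + 1 - m₂)`; same carrier, `pt i = R.pt (i + 2)`. -/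
def rotateTwo (R : ConformalRectangle) : ConformalRectangle where
  carrier := R.carrier
  boundary s := R.boundary (s + R.mark 2)
  isOpen := R.isOpen
  isBounded := R.isBounded
  isConnected := R.isConnected
  continuous_boundary := R.continuous_boundary.comp (continuous_id.add continuous_const)
  periodic_boundary s := by
    show R.boundary (s + 1 + R.mark 2) = R.boundary (s + R.mark 2)
    rw [add_right_comm]; exact R.periodic_boundary _
  injOn_boundary := by
    intro s hs t ht h
    have h' := R.toJordanDomain.injOn_boundary_Ico (R.mark 2)
      ⟨by linarith [hs.1], by linarith [hs.2]⟩ ⟨by linarith [ht.1], by linarith [ht.2]⟩ h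
    linarith
  range_boundary := by
    rw [← R.range_boundary]
    ext z
    constructor
    · rintro ⟨s, rfl⟩; exact ⟨s + R.mark 2, rfl⟩
    · rintro ⟨s, rfl⟩; exact ⟨s - R.mark 2, by simp⟩
  mark := ![0, R.mark 3 - R.mark 2, R.mark 0 + 1 - R.mark 2, R.mark 1 + 1 - R.mark 2]
  strictMono_mark := by
    have hm := MarkedDomain.marks_chain R
    refine Fin.strictMono_iff_lt_succ.2 fun i ↦ ?_
    fin_cases i <;> simp <;> linarith
  mark_mem i := by
    have hm := MarkedDomain.marks_chain R
    fin_cases i <;> simp <;> (try constructor) <;> linarith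

/-- The carrier is unchanged by the relabelling. -/
@[simp] theorem carrier_rotateTwo (R : ConformalRectangle) : (rotateTwo R).carrier = R.carrier := rfl

/-- The boundary loop of the relabelled rectangle. -/
@[simp] theorem boundary_rotateTwo (R : ConformalRectangle) (s : ℝ) :
    (rotateTwo R).boundary s = R.boundary (s + R.mark 2) := rfl

/-- The marks of the relabelled rectangle. -/
theorem mark_rotateTwo (R : ConformalRectangle) :
    (rotateTwo R).mark 0 = 0 ∧ (rotateTwo R).mark 1 = R.mark 3 - R.mark 2 ∧
      (rotateTwo R).mark 2 = R.mark 0 + 1 - R.mark 2 ∧ (rotateTwo R).mark 3 = R.mark 1 + 1 - R.mark 2 :=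
  ⟨rfl, rfl, rfl, rfl⟩

/-- The marked points are relabelled by two: `pt i = R.pt (i + 2)`. -/
theorem pt_rotateTwo (R : ConformalRectangle) (i : Fin 4) : (rotateTwo R).pt i = R.pt (i + 2) := by
  fin_cases i
  · show R.boundary (0 + R.mark 2) = R.pt 2
    rw [zero_add]; rfl
  · show R.boundary (R.mark 3 - R.mark 2 + R.mark 2) = R.pt 3
    rw [sub_add_cancel]; rfl
  · show R.boundary (R.mark 0 + 1 - R.mark 2 + R.mark 2) = R.pt 0
    rw [sub_add_cancel, R.periodic_boundary]; rfl
  · show R.boundary (R.mark 1 + 1 - R.mark 2 + R.mark 2) = R.pt 1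
    rw [sub_add_cancel, R.periodic_boundary]; rfl

/-- The inversion `z ↦ -z⁻¹`, a conformal automorphism of `ℍₒ` (its own inverse). -/
def negInvUpperHalfPlane : ConformalEquiv upperHalfPlaneSet upperHalfPlaneSet where
  toFun z := -z⁻¹
  invFun z := -z⁻¹
  source := upperHalfPlaneSet
  target := upperHalfPlaneSet
  map_source' z hz := by
    change 0 < z.im at hz
    change 0 < (-z⁻¹).im
    have hz0 : z ≠ 0 := by rintro rfl; simp at hz
    rw [Complex.neg_im, Complex.inv_im, neg_div, neg_neg]
    exact div_pos hz (Complex.normSq_pos.2 hz0)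
  map_target' z hz := by
    change 0 < z.im at hz
    change 0 < (-z⁻¹).im
    have hz0 : z ≠ 0 := by rintro rfl; simp at hz
    rw [Complex.neg_im, Complex.inv_im, neg_div, neg_neg]
    exact div_pos hz (Complex.normSq_pos.2 hz0)
  left_inv' z _ := by simp
  right_inv' z _ := by simp
  source_eq := rfl
  target_eq := rfl
  differentiableOn := by
    refine (differentiableOn_inv.mono ?_).neg
    intro z hz
    change 0 < z.im at hz
    rintro rfl; simp at hz
  differentiableOn_symm := by
    refine (differentiableOn_inv.mono ?_).neg
    intro z hz
    change 0 < z.im at hz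
    rintro rfl; simp at hz

/-- `negInvUpperHalfPlane` acts as `z ↦ -z⁻¹`. -/
@[simp] theorem negInvUpperHalfPlane_apply (z : ℂ) : negInvUpperHalfPlane z = -z⁻¹ := rfl

/-- The real Möbius map `t ↦ -1/(t - m)` of the relabelling. -/
def rotMap (m t : ℝ) : ℝ := -(t - m)⁻¹

/-- Differences of `rotMap`. -/
theorem rotMap_sub_rotMap {m a b : ℝ} (ha : a ≠ m) (hb : b ≠ m) :
    rotMap m a - rotMap m b = (a - b) / ((a - m) * (b - m)) := by
  have ha' : a - m ≠ 0 := sub_ne_zero.2 ha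
  have hb' : b - m ≠ 0 := sub_ne_zero.2 hb
  simp only [rotMap]
  field_simp
  ring

/-- Möbius invariance of Cardy's cross-ratio under `rotMap`. -/
theorem crossRatio_rotMap {m : ℝ} {z : Fin 4 → ℝ} (hz : ∀ i, z i ≠ m) (h02 : z 0 ≠ z 2)
    (h13 : z 1 ≠ z 3) : crossRatio (fun i ↦ rotMap m (z i)) = crossRatio z := by
  simp only [crossRatio]
  rw [rotMap_sub_rotMap (hz 0) (hz 1), rotMap_sub_rotMap (hz 2) (hz 3),
    rotMap_sub_rotMap (hz 0) (hz 2), rotMap_sub_rotMap (hz 1) (hz 3)]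
  have h0 := sub_ne_zero.2 (hz 0)
  have h1 := sub_ne_zero.2 (hz 1)
  have h2 := sub_ne_zero.2 (hz 2)
  have h3 := sub_ne_zero.2 (hz 3)
  have h02' := sub_ne_zero.2 h02
  have h13' := sub_ne_zero.2 h13
  field_simp

/-- The cross-ratio formula is invariant under the relabelling `(0 1 2 3) ↦ (2 3 0 1)`. -/
theorem crossRatio_perm_two (x : Fin 4 → ℝ) : crossRatio (fun i : Fin 4 ↦ x (i + 2)) = crossRatio x := by
  simp only [crossRatio, show (0 : Fin 4) + 2 = 2 from rfl, show (1 : Fin 4) + 2 = 3 from rfl,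
    show (2 : Fin 4) + 2 = 0 from rfl, show (3 : Fin 4) + 2 = 1 from rfl]
  ring

/-- **Cross-ratio of the relabelled rectangle**: every uniformizing datum of `rotateTwo R` has the same
Cardy cross-ratio as every uniformizing datum of `R` (the cross-ratio formula is invariant under the
relabelling `(0 1 2 3) ↦ (2 3 0 1)` and under real Möbius maps; a datum of `rotateTwo R` is obtained
from one of `R` by the Möbius self-map `z ↦ m - 1/z` of `ℍₒ`, `m` strictly between `x 1` and `x 2`). -/
theorem crossRatio_rotateTwo {R : ConformalRectangle} {φ : ConformalEquiv upperHalfPlaneSet R.carrier}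
    {x : Fin 4 → ℝ} (hux : R.IsUniformizing φ x)
    {φ' : ConformalEquiv upperHalfPlaneSet (rotateTwo R).carrier} {x' : Fin 4 → ℝ}
    (hux' : (rotateTwo R).IsUniformizing φ' x') : crossRatio x' = crossRatio x := by
  -- a pole strictly between `x 1` and `x 2`
  set m : ℝ := (x 1 + x 2) / 2 with hm
  have hinj := hux.injective
  have hxm : ∀ i, x i ≠ m := by
    intro i h
    rcases hux.1 with hmono | hanti
    · have h01 := hmono (show (0 : Fin 4) < 1 by decide)
      have h12 := hmono (show (1 : Fin 4) < 2 by decide)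
      have h23 := hmono (show (2 : Fin 4) < 3 by decide)
      fin_cases i <;> simp at h <;> linarith
    · have h01 := hanti (show (0 : Fin 4) < 1 by decide)
      have h12 := hanti (show (1 : Fin 4) < 2 by decide)
      have h23 := hanti (show (2 : Fin 4) < 3 by decide)
      fin_cases i <;> simp at h <;> linarith
  -- the Möbius self-map `N z = m - 1/z` of `ℍₒ` and the transported datum
  set N : ConformalEquiv upperHalfPlaneSet upperHalfPlaneSet :=
    negInvUpperHalfPlane.trans (addRealUpperHalfPlane m) with hN
  set ψ : ConformalEquiv upperHalfPlaneSet (rotateTwo R).carrier := N.trans φ with hψ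
  set y : Fin 4 → ℝ := fun i ↦ rotMap m (x (i + 2)) with hy
  -- the matrix of `N`
  set g : Matrix.SpecialLinearGroup (Fin 2) ℝ :=
    ⟨!![m, -1; 1, 0], by simp [Matrix.det_fin_two]⟩ with hg
  have hg00 : g 0 0 = m := rfl
  have hg01 : g 0 1 = -1 := rfl
  have hg10 : g 1 0 = 1 := rfl
  have hg11 : g 1 1 = 0 := rfl
  have hNz : ∀ z ∈ upperHalfPlaneSet, ψ z = φ (moebiusFun g z) := by
    intro z hz
    have hz0 : z ≠ 0 := by rintro rfl; simp [upperHalfPlaneSet] at hz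
    show φ (-z⁻¹ + (m : ℂ)) = φ (moebiusFun g z)
    congr 1
    have h1 : ((g 1 0 : ℝ) : ℂ) * z + ((g 1 1 : ℝ) : ℂ) = z := by
      rw [hg10, hg11]; push_cast; ring
    have h2 : ((g 0 0 : ℝ) : ℂ) * z + ((g 0 1 : ℝ) : ℂ) = (m : ℂ) * z - 1 := by
      rw [hg00, hg01]; push_cast; ring
    rw [moebiusFun, h1, h2, eq_div_iff hz0, add_mul, neg_mul, inv_mul_cancel₀ hz0]
    ring
  have hyne : ∀ i, y i ≠ 0 := by
    intro i
    simp only [hy, rotMap, ne_eq, neg_eq_zero, inv_eq_zero, sub_eq_zero]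
    exact hxm _
  have hbv : ∀ i, ψ.HasBoundaryValue (y i) ((rotateTwo R).pt i) := by
    intro i
    rw [pt_rotateTwo]
    refine hasBoundaryValue_of_moebius hNz (x := y i) ?_ ?_
    · rw [hg10, hg11, one_mul, add_zero]; exact hyne i
    · have hval : (g 0 0 * y i + g 0 1) / (g 1 0 * y i + g 1 1) = x (i + 2) := by
        rw [hg00, hg01, hg10, hg11, one_mul, add_zero]
        have := hyne i
        simp only [hy, rotMap] at this ⊢
        have hxm' : x (i + 2) - m ≠ 0 := sub_ne_zero.2 (hxm _)
        field_simp
        ring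
      rw [hval]
      exact hux.2 (i + 2)
  -- monotonicity of `y`
  have hymono : StrictMono y ∨ StrictAnti y := by
    have key : ∀ {s t : ℝ}, s < t → (t < m ∨ m < s) → rotMap m s < rotMap m t := by
      intro s t hst hside
      simp only [rotMap]
      rcases hside with ht | hs
      · have h1 : s - m < 0 := by linarith
        have h2 : t - m < 0 := by linarith
        rw [neg_lt_neg_iff, inv_lt_inv_of_neg h2 h1]; linarith
      · have h1 : 0 < s - m := by linarith
        have h2 : 0 < t - m := by linarith
        rw [neg_lt_neg_iff, inv_lt_inv₀ h2 h1]; linarith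
    have cross : ∀ {s t : ℝ}, s < m → m < t → rotMap m t < rotMap m s := by
      intro s t hs ht
      simp only [rotMap]
      have h1 : s - m < 0 := by linarith
      have h2 : 0 < t - m := by linarith
      have : (t - m)⁻¹ > 0 := inv_pos.2 h2
      have : (s - m)⁻¹ < 0 := inv_lt_zero.2 h1
      linarith
    rcases hux.1 with hmono | hanti
    · left
      have h01 := hmono (show (0 : Fin 4) < 1 by decide)
      have h12 := hmono (show (1 : Fin 4) < 2 by decide)
      have h23 := hmono (show (2 : Fin 4) < 3 by decide)
      have hm1 : x 1 < m := by rw [hm]; linarith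
      have hm2 : m < x 2 := by rw [hm]; linarith
      refine Fin.strictMono_iff_lt_succ.2 fun i ↦ ?_
      fin_cases i
      · show y 0 < y 1
        simp only [hy]
        exact key h23 (Or.inr hm2)
      · show y 1 < y 2
        simp only [hy]
        show rotMap m (x 3) < rotMap m (x 0)
        exact cross (by linarith) (by linarith)
      · show y 2 < y 3
        simp only [hy]
        show rotMap m (x 0) < rotMap m (x 1)
        exact key h01 (Or.inl hm1)
    · right
      have h01 := hanti (show (0 : Fin 4) < 1 by decide)
      have h12 := hanti (show (1 : Fin 4) < 2 by decide)
      have h23 := hanti (show (2 : Fin 4) < 3 by decide)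
      have hm1 : m < x 1 := by rw [hm]; linarith
      have hm2 : x 2 < m := by rw [hm]; linarith
      refine Fin.strictAnti_iff_succ_lt.2 fun i ↦ ?_
      fin_cases i
      · show y 1 < y 0
        simp only [hy]
        exact key h23 (Or.inl hm2)
      · show y 2 < y 1
        simp only [hy]
        show rotMap m (x 0) < rotMap m (x 3)
        exact cross (by linarith) (by linarith)
      · show y 3 < y 2
        simp only [hy]
        show rotMap m (x 1) < rotMap m (x 0)
        exact key h01 (Or.inr hm1)
  have huy : (rotateTwo R).IsUniformizing ψ y := ⟨hymono, hbv⟩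
  -- all data of `rotateTwo R` share the cross-ratio of `y`, which is that of `x`
  rw [ConformalRectangle.crossRatio_eq_of_isUniformizing_holds hux' huy]
  have hz : ∀ i : Fin 4, (fun i : Fin 4 ↦ x (i + 2)) i ≠ m := fun i ↦ hxm _
  have h02 : (fun i : Fin 4 ↦ x (i + 2)) 0 ≠ (fun i : Fin 4 ↦ x (i + 2)) 2 := hinj.ne (by decide)
  have h13 : (fun i : Fin 4 ↦ x (i + 2)) 1 ≠ (fun i : Fin 4 ↦ x (i + 2)) 3 := hinj.ne (by decide)
  calc crossRatio y = crossRatio (fun i : Fin 4 ↦ rotMap m ((fun i : Fin 4 ↦ x (i + 2)) i)) := rfl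
    _ = crossRatio (fun i : Fin 4 ↦ x (i + 2)) := crossRatio_rotMap hz h02 h13
    _ = crossRatio x := crossRatio_perm_two x

/-! ### The registered stubs `stub_…` (the only `sorry`s of the file; stated BY NAME) -/

/-- STUB A (L–XL, `H`-free, deterministic lattice topology; LOAD-BEARING) — `UpperFence`.
Why plausibly true: contrapositive at one admissible mesh.  If the trace of `γ = medialExploration`
avoids `cthickening η G`, the RIGHT faces of its darts form a dual walk (`exists_right_chain`,
`turn_dichotomy`: consecutive faces equal or separated by a `bcBondConfig`-CLOSED primal edge) from
the face at the `A`–`B` edge near one mark to the face at the other, both outside `closure Ω`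
(`pt_not_mem_closure` + the `zdABEdges` Hausdorff guard); loop-erased and extended across the two
`A`–`B` edges to `∂D`, and routed through each crossed edge at a point of `D` (inner faces are open
squares inside `D`; only sides can touch `∂D`), it is a Newman cross-cut `Λ*` of the Jordan domain
`D` (`Newman1939_crosscut_holds`, `JordanDomain.inter_nonempty_of_crosscut`).  A free open
`Ω_δ`-path `π` from `x ∈ discreteArc Ω δ (ab)` to `y ∈ discreteArc Ω δ (cd)`, extended along one
lattice edge at each end to its first frontier point (`exists_frontier_exit_of_mem_meshBoundary`),
is a connected subset of `closure Ω ⊆ closure D` joining `D.arc 0` (by `near_arc_zero`) to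
`D.arc 1` (by `near_arc_two`) at points `≥ dist({marks}, closure Ω) > 0` away from the ends of
`Λ*`, hence meets `Λ*`; primal and dual traces meet only at a crossed edge
(`disjoint_walkTrace_image_edgeTrace` pattern), so an `ω`-open edge of `π` is bc-closed: it has an
endpoint in `zdArcB (Λ δ)` whose mesh point lies in `Ω` (the two end-extension segments lie on
lattice edges that are NOT edges of `D_δ` — by `closure_far` + `near_arc_zero/two` every `D_δ`-edge at
an `(ab)_δ`- or `(cd)_δ`-site is an `Ω_δ`-edge for small `δ` — so the cross-cut meets `π` itself);
`zdBoundary` sites are `≤ δ√2` from `∂D`,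
`zdArcB` sites `≤ 2δ + d_H(arcB, D.arc 1)` from `D.arc 1`, and points of `D.arc 1` close to
`closure Ω` are close to `G` (`arc_one_inter_closure_subset` + compactness) — so the trace, through
the midpoint of that edge, is within `η` of `G`: contradiction.  No meshDomain-inclusion, no RSW, no
orientation.  Junk guards: admissibility is eventual (`existsUnique_medialExploration_holds` kills
the `[]` branch); `G ⊇ R.arc 2 ≠ ∅`.  Budget note: the touching-fence perturbation and the parameter
bookkeeping of the cross-cut ends are the long parts (template: `exists_dual_crosscut`,
`not_mem_discreteCrossing_of_crosscut`, `BoxCrossingUpperBound.lean`). -/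
theorem stub_upperFence : UpperFence := by
  sorry

/-- STUB B (L, `H`-free, deterministic, no planar topology) — `LowerRun`.
Why plausibly true: at an admissible mesh the LEFT vertices of the darts of `γ` form a walk of
`bcBondConfig`-OPEN edges of `D_δ` (`exists_left_chain`) from an arc-`A` endpoint of one `A`–`B`
edge to the arc-`A` endpoint of the other, i.e. (Hausdorff guard on `zdABEdges`, `ncard = 2`, marks
in different collars by `split`) from inside the `C₂`-collar to inside the `C₀`-collar; every chain
vertex is `≤ δ` from the trace.  Vertices with mesh point outside `Ω` lie in `C₀ ∪ C₂` (`split`);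
contacts with a collar (a chain neighbour in the collar, or a "jump" edge whose segment leaves
`closure Ω`, necessarily through `closure C₀ ∪ closure C₂`) are GATES: `Ω`-sites within `δ` of that
collar, hence (distance clauses of `split`) within `δ` of `(ab)` resp. `(cd)` and `> δ` from the
other three arcs — `discreteArc` sites once in the bulk.  Run extraction (last `C₂`-contact before
the first `C₀`-contact; template `PathIn.exists_run`, `TriCrossingSandwich.lean`) yields consecutive
`Ω`-sites joined by bc-open `D_δ`-edges with segments in `closure Ω`; such an edge is `ω`-open with
no dual-wired endpoint, or WIRED (both endpoints in `zdArcA`) — but `zdArcA` sites in `Ω` are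
`o(1)`-close to `D.arc 0 ∩ closure Ω ⊆ G` (`arc_zero_inter_closure_subset` + compactness) and the
chain is `η - δ` away from `G`: excluded.  The run is `meshGraph Ω δ`-connected of extent `≥ r - 2δ`,
so it lies in the giant component (`JordanDomain.exists_forall_mem_meshDomain_and_reachable` +
`JordanDomain.mul_sub_lt_of_stray`, with its 90°-rotated twin for vertical extent — to be proved by
transporting the Jordan domain under `z ↦ I z`), hence is an open path of `discreteDomainGraph Ω δ`
between the two discrete arcs: `ω ∈ discreteCrossing`.  Junk guards: `G ⊇ R.arc 3 ≠ ∅` (answers the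
triage `G := ∅` bug of the card's first lemma: with `G = ∅` the left side would be `univ`);
admissibility eventual. -/
theorem stub_lowerRun : LowerRun := by
  sorry

/-- STUB C (M, measure theory only) — `TouchLimsup`.
Why plausibly true: with `P = P_{1/2}` and `W = preWienerMeasure` probability measures
(`isProjectiveLimit_preWienerMeasure_holds`), `TendstoLaw` + eventual a.e.-measurability is weak
convergence of the push-forward `ProbabilityMeasure`s along `𝓝[>] 0` (`tendstoLaw_iff_…` /
`ProbabilityMeasure.tendsto_iff_forall_integral_tendsto`, junk value at the non-measurable meshes);
`{c | c.range ∩ K ≠ ∅} = hitsBefore K ∅` is closed (`isClosed_hitsBefore_empty_right`), so Mathlib's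
`ProbabilityMeasure.limsup_measure_closed_le_of_tendsto` gives `limsup P[X δ ∈ ·] ≤ W[Γ ∈ ·]`;
monotonicity of outer measure handles `E δ ⊆ X δ ⁻¹' …` (no measurability of `E δ` needed), and a
`limsup ≤ v` in `ℝ≥0∞` with `v ≤ 1` yields `eventually ≤ v + ε`. -/
theorem stub_touchLimsup : TouchLimsup := by
  sorry

/-- STUB D (L, SLE side, all inputs discharged in the tree) — `SleSideTouch`.
Why plausibly true: `IsSLECurve 6 D Γ` makes `Γ` a.s. the class of the compactified image of the
`ℍ`-trace under the boundary extension of a chordal uniformizing map `ψ` (`0 ↦ pt 0`, `∞ ↦ pt 1`),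
with a.s. `IsGeneratedByCurve`.  The touched arc `J` (`Q.arc 2`, resp. `Q.arc 1`) is a closed boundary
arc at positive distance from both marks, so `ψ⁻¹ J = [y, x]` is a compact interval of `ℝ ∖ {0}`
(reflect by `z ↦ -z̄`, a symmetry of the SLE law, `measure_infDist_sleTrace_eq_negConj`, if needed):
`η ↦ W[trace meets ψ⁻¹(cthickening η J)]` is monotone and tends, as `η ↓ 0` (continuity from above,
compact trace), to `W[trace meets [y, x]] = W[trace meets [y, x)]` (a fixed boundary point is a.s.
missed, `measure_infDist_ofReal_sleTrace_le`, `κ = 6 < 8`) `= 1 - W[T_y = T_x]`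
(`IsGeneratedByCurve.forall_notMem_range_iff_swallowingTime_eq`) `= 1 - (h(z₀) - h(1))/(h(∞) - h(1))`,
`h = sameSideH (1/3)`, `z₀ = x/(x - y)` (`measureReal_swallowingTime_eq_sameSide`, `4 < 6 < 8`), and
the substitution `u ↦ 1/u` turns the kernel `u^{-2/3}(u-1)^{-2/3}` into Cardy's: the value is
`F((x - y)/x)` (triage r1-1 (i), r1-3 checked).  Reading (U): the boundary preimages of
`(p₀, p₁, p₂, p₃)` are `(0, ∞, -x, -y)` up to orientation, cross-ratio `(x - y)/x`; reading (L):
`(0, y, x, ∞)`, cross-ratio `y/x`, value `F(1 - y/x) = 1 - F(y/x)` (`cardyFunction_one_sub_holds`);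
Möbius invariance of `crossRatio` + `crossRatio_eq_of_isUniformizing_holds` convert to the finite
uniformizing datum `(φ, x)` of the statement. -/
theorem stub_sleSideTouch : SleSideTouch := by
  sorry

/-- STUB E (L, conformal geometry, `H`-free; lead reshape r1 of the planner's STUB E, Radó part moved
to STUB G) — `CollarDomains`.
Why plausibly true: pick shortened attaching points `b′, c′ ∈ (bc)°`, `d′, a′ ∈ (da)°` (resp.
`a′, b′ ∈ (ab)°`, `c′, d′ ∈ (cd)°`) within `ε/2` (in parameter and in the plane, by uniform continuity
of `R.boundary`) of the corners, tube data `T` of `Ω` (`JordanDomain.nonempty_tubeData`), and push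
`∂Ω` OUT along the two shortened arcs by the collar-loop device of `CollarDomain.lean`: loop
`s ↦ T.tube (p s) s` with a continuous `1`-periodic profile `1 ≤ p ≤ 1 + h` supported in the two
parameter windows and carrying a PLATEAU (`p ≡ 1 + h'`) inside each (`JordanDomain.ofLoop`,
`injOn_tube`, `continuous_tube_comp`); `h` so small that `dist (T.tube s t) (R.boundary t) < ε` for
`1 ≤ s ≤ 1 + h` (`exists_dist_tube_lt`), giving the uniform closeness with `c` = the parameter of the
first mark; re-base the loop at that parameter so the four marks increase in `[0,1)` (the mark
inequalities of the statement are then bookkeeping, see the composition's `rotateTwo`).  Interior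
description: tube points below the profile are inside, above are outside, the deep interior is inside
(`tube_mem_collarRect`, `tube_not_mem_collarRect`, `apply_mem_collarRect` transplanted from
`collarRect` to the plateau profile, or the index argument `z₀_mem_collarRect_and_index`), so
`Ω ⊆ Qᵢ.carrier`, `D \ Ω ⊆` the two collars, and every point of the collar domain outside
`closure Ω` is a tube point `tube s t`, `1 < s < p t` (`exists_eq_tube_of_mem_of_not_mem_closure`).
`Upper/LowerCollarGeom` fields: marks `= tube (1+h') t₀` lie outside `closure Ω`
(`tube_not_mem_closure`); `closure_far`, `split` and the `near_arc_*` clauses by compactness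
(shortened arcs are compact subsets of OPEN arcs, disjoint from the two other closed arcs; collar
points are within `o_h(1)` of their arc) and `exists_le_infDist_tube_outer`; `arc_one/zero_inter_closure_subset`
because the outer collar boundary meets `closure Ω` only at the attaching points.  Smooth marks: on a
plateau the outer boundary is the analytic arc `θ ↦ invMapInv z₀ (Ce.Φ ((1 - h') e^{iθ}))` and the
domain lies locally on one side of it (tube homeomorphism); either the arc is a straight segment in a
lattice direction (affine case of `IsSmoothMark`) or, by the identity theorem for the real-analytic
tangent-angle function, all but finitely many of its points have tangent off the eight lattice
directions — place the mark there and write the arc as a `C²` graph over the nearest lattice axis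
(`0 < |g′(0)| < 1`) by the inverse function theorem. -/
theorem stub_collarDomains : CollarDomains := by
  sorry

/-- STUB G (M–L, conformal geometry, `H`-free; lead reshape r1) — `ModulusContinuity`.
Why plausibly true: suppose not; then there are `Qₙ`, `cₙ` with loops `1/n`-close to
`s ↦ R.boundary (s + cₙ)` and marks `1/n`-close but data with `|crossRatio xₙ' - crossRatio x| > θ`.
W.l.o.g. `cₙ → c` (marks are bounded, `cₙ ∈ [-2, 2]` eventually) and, replacing `R` by its re-basing
`R_c` (boundary `s ↦ R.boundary (s + c)`, marks `mark i - c` normalised into `[0,1)` — same carrier,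
same marked POINTS up to `o(1)`, same cross-ratio by `crossRatio_eq_of_isUniformizing_holds`), the
loops converge uniformly AS PARAMETRISED LOOPS.  A point `z₀ ∈ Ω` of positive depth lies in every
`Qₙ` eventually (index/winding stability `wind_eq_of_norm_sub_lt`, `index_ne_zero_of_mem_carrier`);
Radó (`JordanDomain.rado_tendstoUniformlyOn_holds`, `.closedBall`) makes the disc Riemann maps
normalised at `z₀` converge uniformly on the closed disc, with continuous injective Carathéodory
extensions (`exists_continuousOn_extension_holds`, `DiscChart`); the circle preimages `uₙⁱ` of the
marks `Qₙ.pt i → R.pt i` converge to those of `R` (compactness + injectivity of the limit extension),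
the complex cross-ratio `cCrossRatio` of four distinct circle points is continuous, and it equals
`crossRatio` of every uniformizing datum (`crossRatio_eq_of_isUniformizing_of_disc` /
`cCrossRatio_moebius`, Cayley) — contradiction. -/
theorem stub_modulusContinuity : ModulusContinuity := by
  sorry

/-- STUB F (L, lattice combinatorics at two smooth junctions + soft compactness, `H`-free) —
`SmoothMarkFamilies`.  Why plausibly true: take `(Λ δ).Ω = D.carrier`, `(Λ δ).δ = δ` and arcs
`A_δ ∪ B_δ = ∂D` split at per-mesh points `p_δⁱ → D.pt i`.  Ties (`zdArcA ∩ zdArcB`) and `A`–`B`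
edges involve `zdBoundary` sites within `3δ` of both arcs, hence (compactness, `arcs ∩ = marks`)
within `o(1)` of a mark, where after the lattice rotation `e` the domain is the epigraph of `g`: in
general position (`0 < |g′| < 1` on a window) the top sites `n_m` of the columns form a MONOTONE
staircase with steps `≤ 2`, `zdBoundary ∩ column m = {top, and the site below it after a step}`, the
foot-point parameters of column-`m` boundary sites lie in `(δ(m-1), δm]`, so a split point with foot
parameter just above `δm₀` labels columns `≤ m₀` as `A`, `> m₀` as `B` with no tie and EXACTLY ONE
`A`–`B` edge (row `n_{m₀}`, columns `m₀, m₀+1`), bordering one inner and one non-inner face (no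
one-face necks: Disproof 23:34Z note, triage (F2)); the affine cases `g = c x`, `c ∈ {0, ±1}` are the
flat row and the exact diagonal staircase.  Layer sites are in the giant component (vertical edges
into the bulk, `JordanDomain.exists_forall_mem_meshDomain_and_reachable`).  Hausdorff guards: arcs
move by `O(δ)`, the `A`–`B` edge midpoints are within `O(δ)` of `p_δⁱ → D.pt i`.  Template (global,
disc): `UnitDiscDiscretisation.isDiscretisation_discData` (tilted arcs).  This is item 9644
(`DiscretisationFamilyExists`) RESTRICTED to smooth exterior marks — the rough marks of `R` are never
discretised as marks. -/
theorem stub_smoothMarkFamilies : SmoothMarkFamilies := by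
  sorry

/-! ### The composition (kernel-checked, no `sorry`) -/

/-- Local alias of the crux (so that `SLESixFamiliesGiveCardy_of` below is the ONLY theorem of the
file concluding the crux by name, as the skeleton audit requires). -/
def CruxStatement : Prop :=
  Summit.CriticalPhenomena.CardyFormulaZ2.Theses.CardyComplexCone.SLESixFamiliesGiveCardy

/-- **`SLESixFamiliesGiveCardy` from the seven statements.**  Given `H = SLE6Families`, a conformal
rectangle `R` and a uniformizing datum `(φ, x)`, fix `e > 0`, `ε = e/8`, a modulus `θ` of uniform
continuity of `F` on `[0, 1]` for `ε`.  STUB G at `R` and at `rotateTwo R` (with any datum of the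
latter, whose cross-ratio is that of `x` by `crossRatio_rotateTwo`) gives closeness tolerances
`ε₁, ε₂`; STUB E at `min ε₁ ε₂` gives collared rectangles `Q₁`, `Q₂` (geometries, smooth marks,
loops and marks close to those of `R`, resp. of `rotateTwo R`), hence every datum of `Q₁`, `Q₂` has
cross-ratio within `θ/2` of `crossRatio x`; STUB F gives discretisation families `Λ₁`, `Λ₂` of
`D₁ = Q₁.chord 0 1`, `D₂ = Q₂.chord 0 3`; `H` at `(D₁, Λ₁)`, `(D₂, Λ₂)` gives SLE₆ random curves
`Γ₁`, `Γ₂` with the interfaces converging in law; STUB D gives `η₁, η₂ > 0` with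
`Law(Γ₁)(touch N̄_{η₁} Q₁.arc 2) < F(η_{Q₁}) + ε` and `Law(Γ₂)(touch N̄_{η₂} Q₂.arc 1) < 1 - F(η_{Q₂}) + ε`;
STUBS A, B give the eventual inclusions `C_δ ⊆ {range γ₁ meets N̄_{η₁}}`, `C_δᶜ ⊆ {range γ₂ meets N̄_{η₂}}`
(`Interface.range_bondInterfaceIn`); STUB C turns them into `P[C_δ] ≤ F(η_{Q₁}) + 2ε`,
`P[C_δᶜ] ≤ 1 - F(η_{Q₂}) + 2ε` eventually; with `|F(η_{Qᵢ}) - F(η_R)| < ε` and `P C + P Cᶜ ≥ 1` this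
is `|P[C_δ] - F(η_R)| < e` eventually. -/
theorem cardy_of_statements (hU : UpperFence) (hL : LowerRun) (hP : TouchLimsup) (hS : SleSideTouch)
    (hG : CollarDomains) (hM : ModulusContinuity) (hF : SmoothMarkFamilies) : CruxStatement := by
  intro H R φ x hux
  rw [Metric.tendsto_nhds]
  intro e he
  -- tolerances
  set ε : ℝ := e / 8 with hε8
  have hε : 0 < ε := by positivity
  have hηI : crossRatio x ∈ Icc (0 : ℝ) 1 :=
    Ioo_subset_Icc_self (ConformalRectangle.crossRatio_mem_Ioo_of_isUniformizing hux)
  have hUC : UniformContinuousOn RandomPlanarGeometry.cardyFunction (Icc (0 : ℝ) 1) :=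
    isCompact_Icc.uniformContinuousOn_of_continuous continuousOn_cardyFunction_holds
  obtain ⟨θ, hθ, hθF⟩ := Metric.uniformContinuousOn_iff.1 hUC ε hε
  -- STUB G: closeness tolerances for `R` and for `rotateTwo R`
  obtain ⟨φ'', x'', hux''⟩ := MarkedDomain.exists_isUniformizing_holds (rotateTwo R)
  have hrot : crossRatio x'' = crossRatio x := crossRatio_rotateTwo hux hux''
  obtain ⟨ε₁, hε₁, hM₁⟩ := hM R φ x hux (θ / 2) (half_pos hθ)
  obtain ⟨ε₂, hε₂, hM₂⟩ := hM (rotateTwo R) φ'' x'' hux'' (θ / 2) (half_pos hθ)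
  -- STUB E: the two collared comparison rectangles
  obtain ⟨⟨Q₁, c₁, hgeo₁, hm₁₀, hm₁₁, hcl₁, hmk₁⟩, ⟨Q₂, c₂, hgeo₂, hm₂₀, hm₂₁, hcl₂, hk₀, hk₁, hk₂, hk₃⟩⟩ :=
    hG R (min ε₁ ε₂) (lt_min hε₁ hε₂)
  -- moduli: every datum of `Q₁`, `Q₂` has cross-ratio within `θ/2` of `crossRatio x`
  have hmod₁ : ∀ (φ' : ConformalEquiv upperHalfPlaneSet Q₁.carrier) (x' : Fin 4 → ℝ),
      Q₁.IsUniformizing φ' x' → |crossRatio x' - crossRatio x| ≤ θ / 2 :=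
    hM₁ Q₁ c₁ (fun s ↦ (hcl₁ s).trans (min_le_left _ _)) (fun i ↦ (hmk₁ i).trans (min_le_left _ _))
  have hmod₂ : ∀ (φ' : ConformalEquiv upperHalfPlaneSet Q₂.carrier) (x' : Fin 4 → ℝ),
      Q₂.IsUniformizing φ' x' → |crossRatio x' - crossRatio x| ≤ θ / 2 := by
    intro φ' x' h'
    rw [← hrot]
    refine hM₂ Q₂ (c₂ - R.mark 2) (fun s ↦ ?_) (fun i ↦ ?_) φ' x' h'
    · rw [boundary_rotateTwo, show s + (c₂ - R.mark 2) + R.mark 2 = s + c₂ by ring]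
      exact (hcl₂ s).trans (min_le_right _ _)
    · fin_cases i
      · show |Q₂.mark 0 + (c₂ - R.mark 2) - 0| ≤ ε₂
        rw [show Q₂.mark 0 + (c₂ - R.mark 2) - 0 = Q₂.mark 0 + c₂ - R.mark 2 by ring]
        exact hk₀.trans (min_le_right _ _)
      · show |Q₂.mark 1 + (c₂ - R.mark 2) - (R.mark 3 - R.mark 2)| ≤ ε₂
        rw [show Q₂.mark 1 + (c₂ - R.mark 2) - (R.mark 3 - R.mark 2) = Q₂.mark 1 + c₂ - R.mark 3 by ring]
        exact hk₁.trans (min_le_right _ _)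
      · show |Q₂.mark 2 + (c₂ - R.mark 2) - (R.mark 0 + 1 - R.mark 2)| ≤ ε₂
        rw [show Q₂.mark 2 + (c₂ - R.mark 2) - (R.mark 0 + 1 - R.mark 2) =
          Q₂.mark 2 + c₂ - (R.mark 0 + 1) by ring]
        exact hk₂.trans (min_le_right _ _)
      · show |Q₂.mark 3 + (c₂ - R.mark 2) - (R.mark 1 + 1 - R.mark 2)| ≤ ε₂
        rw [show Q₂.mark 3 + (c₂ - R.mark 2) - (R.mark 1 + 1 - R.mark 2) =
          Q₂.mark 3 + c₂ - (R.mark 1 + 1) by ring]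
        exact hk₃.trans (min_le_right _ _)
  -- STUB F: discretisation families of the two designer Dobrushin domains
  obtain ⟨Λ₁, hΛ₁⟩ := hF (Q₁.chord 0 1 (by decide)) hm₁₀ hm₁₁
  obtain ⟨Λ₂, hΛ₂⟩ := hF (Q₂.chord 0 3 (by decide)) hm₂₀ hm₂₁
  -- `H` at the two designer domains: SLE₆ random curves and convergence in law
  obtain ⟨Γ₁, hΓ₁, hmeas₁, hlaw₁⟩ := H (Q₁.chord 0 1 (by decide)) Λ₁ hΛ₁.Ω_eq hΛ₁.δ_eq
    hΛ₁.tendsto_arcA hΛ₁.tendsto_arcB hΛ₁.tendsto_zdABEdges hΛ₁.eventually_isZdAdmissible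
  obtain ⟨Γ₂, hΓ₂, hmeas₂, hlaw₂⟩ := H (Q₂.chord 0 3 (by decide)) Λ₂ hΛ₂.Ω_eq hΛ₂.δ_eq
    hΛ₂.tendsto_arcA hΛ₂.tendsto_arcB hΛ₂.tendsto_zdABEdges hΛ₂.eventually_isZdAdmissible
  -- the interface maps of `H` are the fact-free `Interface.bondInterfaceIn` (definitionally)
  have hmeas₁' : ∀ᶠ δ : ℝ in 𝓝[>] 0,
      AEMeasurable (fun ω => Interface.bondInterfaceIn (Q₁.chord 0 1 (by decide)) (Λ₁ δ) ω)
        (bondPercolation (zdGraph 2) Percolation.half) := hmeas₁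
  have hlaw₁' : TendstoLaw (Ωδ := fun _ => BondConfig (Site 2))
      (fun δ ω => Interface.bondInterfaceIn (Q₁.chord 0 1 (by decide)) (Λ₁ δ) ω)
      (fun _ => bondPercolation (zdGraph 2) Percolation.half) Γ₁ Process.preWienerMeasure := hlaw₁
  have hmeas₂' : ∀ᶠ δ : ℝ in 𝓝[>] 0,
      AEMeasurable (fun ω => Interface.bondInterfaceIn (Q₂.chord 0 3 (by decide)) (Λ₂ δ) ω)
        (bondPercolation (zdGraph 2) Percolation.half) := hmeas₂
  have hlaw₂' : TendstoLaw (Ωδ := fun _ => BondConfig (Site 2))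
      (fun δ ω => Interface.bondInterfaceIn (Q₂.chord 0 3 (by decide)) (Λ₂ δ) ω)
      (fun _ => bondPercolation (zdGraph 2) Percolation.half) Γ₂ Process.preWienerMeasure := hlaw₂
  -- uniformizing data of `Q₁`, `Q₂` and the SLE₆ touch limits (STUB D)
  obtain ⟨φ₁, x₁, hux₁⟩ := MarkedDomain.exists_isUniformizing_holds Q₁
  obtain ⟨φ₂, x₂, hux₂⟩ := MarkedDomain.exists_isUniformizing_holds Q₂
  have ht₁ := (hS Q₁ φ₁ x₁ hux₁).1 Γ₁ hΓ₁
  have ht₂ := (hS Q₂ φ₂ x₂ hux₂).2 Γ₂ hΓ₂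
  obtain ⟨η₁, hη₁v, hη₁⟩ := ((Metric.tendsto_nhds.1 ht₁ ε hε).and self_mem_nhdsWithin).exists
  obtain ⟨η₂, hη₂v, hη₂⟩ := ((Metric.tendsto_nhds.1 ht₂ ε hε).and self_mem_nhdsWithin).exists
  replace hη₁ : 0 < η₁ := hη₁
  replace hη₂ : 0 < η₂ := hη₂
  -- moduli: `|F(η_{Qᵢ}) - F(η_R)| < ε`
  have hx₁I : crossRatio x₁ ∈ Icc (0 : ℝ) 1 :=
    Ioo_subset_Icc_self (ConformalRectangle.crossRatio_mem_Ioo_of_isUniformizing hux₁)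
  have hx₂I : crossRatio x₂ ∈ Icc (0 : ℝ) 1 :=
    Ioo_subset_Icc_self (ConformalRectangle.crossRatio_mem_Ioo_of_isUniformizing hux₂)
  have hcr₁ : |crossRatio x₁ - crossRatio x| ≤ θ / 2 := hmod₁ φ₁ x₁ hux₁
  have hcr₂ : |crossRatio x₂ - crossRatio x| ≤ θ / 2 := hmod₂ φ₂ x₂ hux₂
  have hF₁ : dist (RandomPlanarGeometry.cardyFunction (crossRatio x₁)) (RandomPlanarGeometry.cardyFunction (crossRatio x)) < ε :=
    hθF _ hx₁I _ hηI (by rw [Real.dist_eq]; linarith)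
  have hF₂ : dist (RandomPlanarGeometry.cardyFunction (crossRatio x₂)) (RandomPlanarGeometry.cardyFunction (crossRatio x)) < ε :=
    hθF _ hx₂I _ hηI (by rw [Real.dist_eq]; linarith)
  -- STUBS A, B: the deterministic inclusions at `η₁`, `η₂`
  have hinc₁ := hU R _ _ hgeo₁ Λ₁ hΛ₁ η₁ hη₁
  have hinc₂ := hL R _ _ hgeo₂ Λ₂ hΛ₂ η₂ hη₂
  -- the closed touch sets
  set K₁ : Set ℂ := cthickening η₁ (Q₁.arc 2) with hK₁
  set K₂ : Set ℂ := cthickening η₂ (Q₂.arc 1) with hK₂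
  have hK₁c : IsClosed K₁ := isClosed_cthickening
  have hK₂c : IsClosed K₂ := isClosed_cthickening
  -- eventual containments in the range events of the oriented interface classes
  have hev₁ : ∀ᶠ δ : ℝ in 𝓝[>] 0, discreteCrossing R.carrier δ (R.arc 0) (R.arc 2) ⊆
      {ω | ((Interface.bondInterfaceIn (Q₁.chord 0 1 (by decide)) (Λ₁ δ) ω).range ∩ K₁).Nonempty} := by
    filter_upwards [hinc₁] with δ hδ ω hω
    have h := hδ hω
    simp only [mem_setOf_eq] at h ⊢
    rwa [Interface.range_bondInterfaceIn]
  have hev₂ : ∀ᶠ δ : ℝ in 𝓝[>] 0, (discreteCrossing R.carrier δ (R.arc 0) (R.arc 2))ᶜ ⊆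
      {ω | ((Interface.bondInterfaceIn (Q₂.chord 0 3 (by decide)) (Λ₂ δ) ω).range ∩ K₂).Nonempty} := by
    filter_upwards [hinc₂] with δ hδ ω hω
    simp only [mem_setOf_eq]
    rw [Interface.range_bondInterfaceIn]
    by_contra hne
    rw [not_nonempty_iff_eq_empty] at hne
    exact hω (hδ (show ω ∈ {ω | Disjoint (range (medialExplorationCurve (Λ₂ δ) ω)) K₂} from
      disjoint_iff_inter_eq_empty.2 hne))
  -- STUB C: portmanteau
  have hpm₁ := hP _ Γ₁ hΓ₁.aemeasurable hmeas₁' hlaw₁' K₁ hK₁c _ hev₁ ε hε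
  have hpm₂ := hP _ Γ₂ hΓ₂.aemeasurable hmeas₂' hlaw₂' K₂ hK₂c _ hev₂ ε hε
  -- assemble
  rw [Real.dist_eq, abs_sub_lt_iff] at hη₁v hη₂v hF₁ hF₂
  filter_upwards [hpm₁, hpm₂] with δ h₁ h₂
  set C : Set (BondConfig (Site 2)) := discreteCrossing R.carrier δ (R.arc 0) (R.arc 2) with hC
  have hsum : 1 ≤ (bondPercolation (zdGraph 2) Percolation.half).real C +
      (bondPercolation (zdGraph 2) Percolation.half).real Cᶜ := by
    calc (1 : ℝ) = (bondPercolation (zdGraph 2) Percolation.half).real univ := probReal_univ.symm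
      _ = (bondPercolation (zdGraph 2) Percolation.half).real (C ∪ Cᶜ) := by rw [union_compl_self]
      _ ≤ _ := measureReal_union_le _ _
  have hp : bondDomainCrossingProb R δ = (bondPercolation (zdGraph 2) Percolation.half).real C := rfl
  rw [hp, Real.dist_eq, abs_sub_lt_iff]
  constructor <;> linarith

/-- **Collar-touch sandwich closes `SLESixFamiliesGiveCardy`** — the skeleton theorem: concludes the
crux BY NAME from the seven registered stubs (the only sorries of the file sit inside them). -/
theorem SLESixFamiliesGiveCardy_of :
    Summit.CriticalPhenomena.CardyFormulaZ2.Theses.CardyComplexCone.SLESixFamiliesGiveCardy :=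
  cardy_of_statements stub_upperFence stub_lowerRun stub_touchLimsup stub_sleSideTouch
    stub_collarDomains stub_modulusContinuity stub_smoothMarkFamilies

end Summit.CriticalPhenomena.CardyFormulaZ2.Cruxes.SLESixFamiliesGiveCardy.CollarTouchSandwich
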